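/-
Copyright: statement-level skeleton of a published paper (lit-balaban cell, Phase-2 proof seat p39 gen 31). No proof claims
beyond what the kernel checks below.
-/
import Literature.MathematicalPhysics.QuantumFieldTheory.Balaban1983to89.B3Eq122FirstOrderWick

/-!
# Bałaban, *(Higgs)₂,₃ quantum fields in a finite volume. III*, CMP 88 (1983) [Balaban1983Higgs3], pp. 416–417: TWO
# WICK-ORDERED QUARTIC VERTICES AGAINST A BILINEAR INSERTION — the Gaussian integral
# `∫W₀·:∣φ(y)∣⁴:·:∣φ(y′)∣⁴:·⟪φ(u),Mφ(v)⟫ = Z₀·[8N(N+2)C₀(y′,y)⁴·C₀(u,v)·tr M + 32(N+2)·tr M·C₀(y′,y)³·(C₀(u,y)C₀(y′,v) + C₀(v,y)C₀(y′,u))]`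
# (the "basketball" times the loop of the insertion, plus THE SUNSET WITH ONE LINE DRESSED by the insertion), summed over the
# vertices, its connected part `κ₃(B; V_:, V_:)`, the mass-vertex case `κ₃(Q; V_:, V_:)` and finite families `Σ_lκ_lB_l` (print's ②)
# — the first of the three-loop vacuum kernels of (1.24) at the index `(2,2)`

statement-level skeleton of published theorems with citation tags; proofs where landed; nothing here is a claim about the
Yang–Mills mass gap.

[cite: Balaban1983Higgs3, (1.19)–(1.22) p.416 (PDF 6); (1.23)–(1.24) p.417 (PDF 7); first paragraph of p.418 (PDF 8)]
[cite: GlimmJaffeQP1987, §8.3 (Gaussian integration by parts / Wick's theorem), Prop. 8.3.1, Cor. 8.3.2 (8.3.8)–(8.3.9), §8.5].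
Unit `lit-balaban-p39-g31` (Phase-2 proof seat p39, gen 31), free-target protocol G.5-34(d), ZERO head weight: an OPTIONAL
Wick-calculus located member of rows **B3.Eq1.19-1.22** / **B3.Eq1.24** of `HOME/lit-balaban-r15/ROWS-B3.md` (owner r15; heads
`proved`, decls of record not restated here); TAKING `HOME/STATUS.md` 2026-08-24T18:21:25Z, owner r15 NO OBJECTION 18:22:10Z with
the word that an explicit graph-by-graph list of the `(2,2)` vacuum term is NOT wanted for the (1.24) cell — so this file is the
generic kernel only (BRICK 19 of this seat's series; BRICK 17 `B3Eq124IndexTwoTwo` left the `(2,2)` term of (1.24) in cumulant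
form `κ₃(Y; V_:, V_:) − δm²_{(0,2)}·Cov₀(Y,Q)` with its three-loop kernels unevaluated, its HONEST SCOPE (a)).  IMPORTED: BRICK 1
`B3Eq122FirstOrderWick` (this seat, gen 22: the contraction chain `derivAlong_wick4_1 … _4`, `_1k`, `_1kk` of `:∣φ(z)∣⁴:` along
the legs of another vertex, `integral_wick4_rem2(')`, `integral_wick4_wick4`, `integral_sumWick4_sq`), and through it this seat's
`B3WickVertexCalculus` (`wick4`, `ExpGrowth`, `DerivAlong`, `hx`, `integral_wick4_mul`, `expGrowth_wick4`), `B3WTCovariance`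
(`moment2`, `moment2_op`, `trE`, `integrable_weight_mul_inner_inner`), `B3WT226Traces.Z_pos`.  Nothing of record is redeclared.

PDF held: `paper:balaban1983-higgs-2-3-quantum-fields-finite-volume` (journal page = PDF page + 410); (1.19)–(1.24) read for
BRICKS 1/7/12–18 on the ×2 renders `run/shared/lean/pub/pub-balaban/b2b-balaban-ref1/pages/1983-cmp88-higgs23-III/
1983-cmp88-higgs23-III-p006-x2.png`, `…-p007-x2.png`, `…-p008-x2.png` (quotations as verified there by ref-1 g107/g108/g114 and
ref-4 g90/g91/g95 for those bricks); the three sentences quoted below re-read this session on the OCR layer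
`~/.lit/texts/paper-balaban1983-higgs-2-3-quantum-fields-finite-volume/p0006.txt` L32–33, `p0007.txt` L35–36, `p0008.txt` L2–4.

THE PRINTED TEXT this calculus serves (verbatim, p. 416): *"Let us write a few terms of the expansion of Σ^ε: Σ^ε(x−x′) =
−4(N+2)λC^ε_0(0)δ^ε(x−x′) + e²dC^ε(0)q²δ^ε(x−x′) + … (1.22) Here we did not write, and we will not write in the future,
combinatoric factors before the graphs, understanding that they are a part of the graphical description."*; p. 417: *"Now
it is easy to define the vacuum energy counterterm E₁. It is defined by the following perturbation expansion: E₁ = Σ_{1≤α+β≤n̄}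
(1/(α!β!))e^αλ^β(∂^{α+β}/∂e^α∂λ^β log∫dA∫dφ e^{−S^ε(A,φ)})∣_{e=λ=0} (1.24)"*; p. 418: *"Terms of this expansion are described by
connected graphs without external legs (vacuum graphs)."*  Print lists NO vacuum graph individually; the graphs named below are
(ours), the standard Feynman-graph reading of the Gaussian integrals (Glimm–Jaffe §8.3–8.5).

WHICH TERM / WHICH GRAPHS OF (1.22)–(1.24) THIS DRESSES (owner r15's standing ask).  The bilinear insertion `B = ⟪φ(u),Mφ(v)⟫`
stands for: print's ② of (1.22) — after the `A`-integration the seagull vertex (1.8)_{2,0}/(1.10)_{2,0} becomes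
`Σ_bη^dc²η²C^ε(b₋,b₋)⟪φ(b₋),q²φ(b₊)⟫` (BRICK 7 `integral_D2_J_zero`; `M = q²`, `(u,v) = (b₋,b₊)`) —, and the mass counterterm
vertex (1.7) `−δm²_{(2,0)}Σ_zη^d∣φ(z)∣²` (`M = 1`, `u = v = z`).  Against TWO Wick-ordered quartic vertices (1.6) (the `λ²` of
the index `(2,2)`), the Gaussian integral `∫W₀:∣φ(y)∣⁴::∣φ(y′)∣⁴:B` is the sum of two graphs (§2): the basketball `y ⇶ y′` (four
lines) times the closed loop `u —M— v` of the insertion — DISCONNECTED, it cancels in the cumulant (§3 `cum3_bil_sumWick4_sq`) —,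
and the SUNSET `y ≡ y′` (three lines) with one of its lines opened at the insertion, `y — u —M— v — y′` (`32(N+2)tr M·C₀(y′,y)³·
C₀(u,y)C₀(y′,v)`, plus `u ↔ v`); the "two legs into each" terms (the Wick-ordered quadratic remainder at `y′` against the constant
second derivative of `B`) vanish.  NOT covered: the ④ part of BRICK 17's insertion `Y` (two currents `⟪φ(b₋),qφ(b₊)⟫⟪φ(b′₋),
qφ(b′₊)⟫` joined by the vector line — quartic in `φ`: the sunset with a ④-dressed line AND the graph whose vector line bridges two
sunset lines) and the `δm²_{(0,2)}·Cov₀(Y,Q)` bubble; hence this file does NOT assemble the `(2,2)` term of (1.24) as a propagator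
sum (not wanted by the row owner, 2026-08-24T18:22:10Z), it supplies the kernel a successor would use for two of its three pieces.

THE SETTING = BRICK 1's: the model torus `T^{(j)}_η` of `B3WT223Instance` (print's `T_ε`, `η = ε`, volume element `w = η^d`,
`c = η⁻¹`), scalar fields `φ : T → ℝ^N` (`Cfg`), the free scalar Gaussian weight `W₀ = weight C η w c m2 0` (written out in the
statements; print's `dμ_{C^ε_0}` up to `Z₀ = ∫W₀`), `C₀ = B3WTPropagator.G w c m2` (print's `C^ε_0`, symmetric), `:∣φ(y)∣⁴: = wick4 w c m2 y`,
`V_: = Σ_yη^d:∣φ(y)∣⁴:`, `tr M = trE M = Σ_i⟪e_i,Me_i⟫`.  Hypotheses: `η^d > 0`, `m² > 0`; any level `j`, mesh, dimension, `N`,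
any operator `M` on `ℝ^N`, any sites `y, y′, u, v`.

WHAT THIS FILE PROVES (theorems only; no definition, no named fact, no `sorry`; standard axioms).
* §1 (private) basis sums, `⟪e_a,M*e_b⟫ = ⟪e_b,Me_a⟫`, a `2 × 2` table of second moments.
* §2 **`integral_wick4_wick4_bil`**: `∫W₀:∣φ(y)∣⁴::∣φ(y′)∣⁴:⟪φ(u),Mφ(v)⟫ = Z₀[8N(N+2)C₀(y′,y)⁴C₀(u,v)tr M + 32(N+2)tr M·C₀(y′,y)³
  (C₀(u,y)C₀(y′,v) + C₀(v,y)C₀(y′,u))]` — `B3WickVertexCalculus.integral_wick4_mul` at `y` with the explicit Leibniz chain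
  `R₁ … R₄` of `:∣φ(y′)∣⁴:·B` (BRICK 1's six contraction lemmas at `y′`, the two derivatives of `B`), the left-over integrals at `y′`
  being `moment2_op` (four legs absorbed), `moment2 ×4` (three legs) and `integral_wick4_rem2(')` = 0 (two legs); the index sums
  `Σ_{i,k}(1 + 2δ_{ik}²) = N(N+2)`, `Σ_{i,k}[M_{kk} + M_{ii} + 2δ_{ik}(M_{ki} + M_{ik})] = (2N+4)tr M`.  (Consistency: with `M =
  e_a ⊗ e_b`, `(u,v) = (x,x′)` — `tr M = δ_{ab}` — this is BRICK 1's `integral_wick4_wick4_legs` (the sunset ⑥ of (1.22) against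
  the two external legs), `4²(2N+4) = 32(N+2)`; not re-derived from it, the bilinear being general.)
* §3 **`integral_bil_sumWick4_sq`** (`∫W₀·B·V_:²`, summed over the two vertices) and **`cum3_bil_sumWick4_sq`**:
  `[∫W₀(B·V_:²)·Z₀ − ∫W₀V_:²·∫W₀B]/Z₀² = Σ_{y,y′}η^{2d}·32(N+2)tr M·C₀(y′,y)³(C₀(u,y)C₀(y′,v) + C₀(v,y)C₀(y′,u))` — the basketball ×
  loop cancels against `⟨V_:²⟩₀⟨B⟩₀` (BRICK 1 `integral_sumWick4_sq`, `moment2_op`): the connected sunset with one dressed line, i.e.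
  the joint cumulant `κ₃(B; V_:, V_:)` of BRICK 17 §10 for a bilinear insertion (`⟨V_:⟩₀ = 0`, `Cov₀(B,V_:) = 0`).
* §4 (private `trE_one`) **`cum3_massForm_sumWick4_sq`**: the mass counterterm vertex `Q = Σ_zη^d∣φ(z)∣²` (`M = 1`, `u = v = z`,
  summed over `z`): `[∫W₀(Q·V_:²)·Z₀ − ∫W₀V_:²·∫W₀Q]/Z₀² = Σ_zη^dΣ_{y,y′}η^{2d}·64N(N+2)·C₀(y′,y)³C₀(z,y)C₀(y′,z)` — the
  `−δm²_{(2,0)}Q` part of BRICK 17's `κ₃(Y; V_:, V_:)` per unit `−δm²_{(2,0)}`.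
* §5 **`cum3_sumBil_sumWick4_sq`**: a finite family `X = Σ_{l∈s}κ_l⟪φ(u_l),M_lφ(v_l)⟫` (the cumulant is linear in the insertion):
  `κ₃(X; V_:, V_:) = Σ_lκ_l·Σ_{y,y′}η^{2d}·32(N+2)tr M_l·C₀(y′,y)³(C₀(u_l,y)C₀(y′,v_l) + C₀(v_l,y)C₀(y′,u_l))` — with `s` = the
  bonds, `κ_b = η^dc²η²C^ε(b₋,b₋)`, `M_b = q²`, `(u_b,v_b) = (b₋,b₊)` the ② part of BRICK 17's `κ₃(Y; V_:, V_:)` (instantiation left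
  to the consumer: one `rfl` on BRICK 17's `hX`'s first sum).

HONEST SCOPE.  (a) A Gaussian (free-field, `e = 0`) identity on the finite torus at fixed `ε = η`; nothing is uniform in `ε`, no
claim about (1.24)'s convergence statement on p. 418.  (b) Generic bilinear `B` (§2–§3), the mass vertex (§4), finite families (§5, print's ② up
to naming the bond set); the ④ (two-current, quartic) insertion and the `δm²_{(0,2)}·Cov₀(Y,Q)` bubble are NOT treated, so two of
the three pieces of BRICK 17's `κ₃(Y; V_:, V_:)` are evaluated here and the `(2,2)` term is not assembled (above).  (c) Combinatoric
factors: print writes none (*"understanding that they are a part of the graphical description"*); the `8N(N+2)`, `32(N+2)` here are the kernel-checked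
pairing counts for `O(N)`-vector fields with the vertex `:∣φ∣⁴: = :(φ·φ)²:`, consistent with BRICK 1 (`8N(N+2)`, `4²(2N+4)`) and
BRICK 15 (`64N(N+2)(N+8)` for the triangle).  (d) The identification of `B` with ② / the mass vertex reads (1.22)–(1.24) on BRICK
7's Feynman-gauge carrier as in BRICKS 7/13/14/16/17; it is said here, not proved here.

References: [Balaban1983Higgs3] T. Bałaban, *(Higgs)₂,₃ quantum fields in a finite volume. III. Renormalization*, CMP 88 (1983)
411–445, (1.19)–(1.24) pp. 416–418; [GlimmJaffeQP1987] J. Glimm, A. Jaffe, *Quantum Physics. A Functional Integral Point of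
View*, 2nd ed. (Springer 1987), §6.3, §8.3–8.5, Prop. 8.3.1, Cor. 8.3.2.
-/

noncomputable section

open scoped BigOperators InnerProductSpace

namespace Literature.MathematicalPhysics.QuantumFieldTheory.Balaban1983to89.B3Eq124SunsetKernels

open _root_.MeasureTheory
open LatticeFieldCalculus B3WT223Instance B3WTPropagator B3WTCovariance B3WickVertexCalculus B3Eq122FirstOrderWick

variable {P : Params} {j N : ℕ} (C : HiggsLattice.ChargeData N) (η w c m2 : ℝ)

/-! ## §1 Toolbox (file-local): basis sums, the adjoint on matrix elements, a two-by-two table of second moments -/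

omit C η w c m2 in
/-- `⟪e_a, e_b⟫ = δ_{ab}`. [folklore] -/
private theorem inner_basis (a b : Fin N) : ⟪(EuclideanSpace.basisFun (Fin N) ℝ) a, (EuclideanSpace.basisFun (Fin N) ℝ) b⟫_ℝ = if a = b then 1 else 0 := by
  classical
  exact orthonormal_iff_ite.mp (EuclideanSpace.basisFun (Fin N) ℝ).orthonormal a b

omit C η w c m2 in
/-- `Σ_{i,k}⟪e_k,e_i⟫² = N`. [folklore] -/
private theorem sum_sum_inner_basis_sq : ∑ i : Fin N, ∑ k : Fin N, ⟪(EuclideanSpace.basisFun (Fin N) ℝ) k, (EuclideanSpace.basisFun (Fin N) ℝ) i⟫_ℝ ^ 2 = N := by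
  classical
  have e : ∀ i k : Fin N, ⟪(EuclideanSpace.basisFun (Fin N) ℝ) k, (EuclideanSpace.basisFun (Fin N) ℝ) i⟫_ℝ ^ 2 = if k = i then 1 else 0 := fun i k => by
    rw [inner_basis]; split_ifs <;> simp
  simp_rw [e, Finset.sum_ite_eq', if_pos (Finset.mem_univ _), Finset.sum_const, Finset.card_univ, Fintype.card_fin,
    nsmul_eq_mul, mul_one]

omit C η w c m2 in
/-- `⟪e_a, M*e_b⟫ = ⟪e_b, Me_a⟫` (real adjoint). [folklore] -/
private theorem inner_adjoint_basis (M : EuclideanSpace ℝ (Fin N) →L[ℝ] EuclideanSpace ℝ (Fin N)) (a b : Fin N) :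
    ⟪(EuclideanSpace.basisFun (Fin N) ℝ) a, ContinuousLinearMap.adjoint M ((EuclideanSpace.basisFun (Fin N) ℝ) b)⟫_ℝ = ⟪(EuclideanSpace.basisFun (Fin N) ℝ) b, M ((EuclideanSpace.basisFun (Fin N) ℝ) a)⟫_ℝ := by
  rw [ContinuousLinearMap.adjoint_inner_right, real_inner_comm]

/-- the `2 × 2` table of second moments `∫W₀(pφ·a₁ + qφ·a₂)(z)·(rφ(x)·v₁ + sφ(x′)·v₂)` (`B3WTCovariance.moment2` four times).
[cite: GlimmJaffeQP1987, Thm 6.3.1 (6.3.3)] -/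
private theorem integral_lin_lin (hw : 0 < w) (hm : 0 < m2) (z x x' : Site P j)
    (a₁ a₂ v₁ v₂ : EuclideanSpace ℝ (Fin N)) (p q r s : ℝ) :
    ∫ φ, weight C η w c m2 (0 : VecField P j ℝ) φ * ((p * ⟪φ z, a₁⟫_ℝ + q * ⟪φ z, a₂⟫_ℝ) * (r * ⟪φ x, v₁⟫_ℝ + s * ⟪φ x', v₂⟫_ℝ)) =
      (∫ φ, weight C η w c m2 (0 : VecField P j ℝ) φ) * (p * r * (G w c m2 z x * ⟪a₁, v₁⟫_ℝ) + p * s * (G w c m2 z x' * ⟪a₁, v₂⟫_ℝ)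
        + q * r * (G w c m2 z x * ⟪a₂, v₁⟫_ℝ) + q * s * (G w c m2 z x' * ⟪a₂, v₂⟫_ℝ)) := by
  have mo1 := moment2 C η w c m2 hw hm z x a₁ v₁
  have mo2 := moment2 C η w c m2 hw hm z x' a₁ v₂
  have mo3 := moment2 C η w c m2 hw hm z x a₂ v₁
  have mo4 := moment2 C η w c m2 hw hm z x' a₂ v₂
  have i1 := integrable_weight_mul_inner_inner C η w c m2 hw hm z x a₁ v₁
  have i2 := integrable_weight_mul_inner_inner C η w c m2 hw hm z x' a₁ v₂
  have i3 := integrable_weight_mul_inner_inner C η w c m2 hw hm z x a₂ v₁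
  have i4 := integrable_weight_mul_inner_inner C η w c m2 hw hm z x' a₂ v₂
  have e : (fun φ : Cfg P j N => weight C η w c m2 (0 : VecField P j ℝ) φ * ((p * ⟪φ z, a₁⟫_ℝ + q * ⟪φ z, a₂⟫_ℝ) * (r * ⟪φ x, v₁⟫_ℝ + s * ⟪φ x', v₂⟫_ℝ))) =
      fun φ => p * r * (weight C η w c m2 (0 : VecField P j ℝ) φ * (⟪φ z, a₁⟫_ℝ * ⟪φ x, v₁⟫_ℝ)) + p * s * (weight C η w c m2 (0 : VecField P j ℝ) φ * (⟪φ z, a₁⟫_ℝ * ⟪φ x', v₂⟫_ℝ))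
        + q * r * (weight C η w c m2 (0 : VecField P j ℝ) φ * (⟪φ z, a₂⟫_ℝ * ⟪φ x, v₁⟫_ℝ)) + q * s * (weight C η w c m2 (0 : VecField P j ℝ) φ * (⟪φ z, a₂⟫_ℝ * ⟪φ x', v₂⟫_ℝ)) := by
    funext φ; ring
  have i12 : Integrable (fun φ : Cfg P j N => p * r * (weight C η w c m2 (0 : VecField P j ℝ) φ * (⟪φ z, a₁⟫_ℝ * ⟪φ x, v₁⟫_ℝ))
      + p * s * (weight C η w c m2 (0 : VecField P j ℝ) φ * (⟪φ z, a₁⟫_ℝ * ⟪φ x', v₂⟫_ℝ))) := (i1.const_mul _).add (i2.const_mul _)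
  have i123 : Integrable (fun φ : Cfg P j N => p * r * (weight C η w c m2 (0 : VecField P j ℝ) φ * (⟪φ z, a₁⟫_ℝ * ⟪φ x, v₁⟫_ℝ))
      + p * s * (weight C η w c m2 (0 : VecField P j ℝ) φ * (⟪φ z, a₁⟫_ℝ * ⟪φ x', v₂⟫_ℝ)) + q * r * (weight C η w c m2 (0 : VecField P j ℝ) φ * (⟪φ z, a₂⟫_ℝ * ⟪φ x, v₁⟫_ℝ))) :=
    i12.add (i3.const_mul _)
  rw [e, integral_add i123 (i4.const_mul _), integral_add i12 (i3.const_mul _), integral_add (i1.const_mul _) (i2.const_mul _),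
    integral_const_mul, integral_const_mul, integral_const_mul, integral_const_mul, mo1, mo2, mo3, mo4]
  ring

/-! ## §2 TWO WICK-ORDERED QUARTIC VERTICES AGAINST A BILINEAR INSERTION -/

/-- **WICK'S THEOREM FOR `:∣φ(y)∣⁴:·:∣φ(y′)∣⁴:` AGAINST A BILINEAR VERTEX `⟪φ(u),Mφ(v)⟫`** (`g = C₀(y′,y)`):
`∫W₀·:∣φ(y)∣⁴:·:∣φ(y′)∣⁴:·⟪φ(u),Mφ(v)⟫ = Z₀·[8N(N+2)g⁴·C₀(u,v)tr M + 32(N+2)tr M·g³·(C₀(u,y)C₀(y′,v) + C₀(v,y)C₀(y′,u))]`.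
All four legs of the vertex at `y` are contracted into the rest (this seat's `B3WickVertexCalculus.integral_wick4_mul`), Leibniz
over BRICK 1's contraction chain of `:∣φ(y′)∣⁴:` (`derivAlong_wick4_1 … _4`, `_1k`, `_1kk`) and the two derivatives of the bilinear:
the vertex at `y′` absorbs FOUR legs (the basketball `8N(N+2)g⁴` times the loop `C₀(u,v)tr M` of the insertion — disconnected),
THREE legs (its last leg and one leg of `y` meet in the insertion: the sunset `y — y′` with one of its three lines dressed,
`2 × 16(N+2)`), or TWO legs (the Wick-ordered quadratic remainder at `y′` against a constant: zero, `integral_wick4_rem2`).  With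
`M = q²`, `(u,v) = (b₋,b₊)` this is print's ② inserted into the order-`λ²` vacuum graph; with `M = 1`, `u = v` the mass
counterterm vertex. [cite: Balaban1983Higgs3, (1.24) p.417; (1.22)–(1.23) pp.416–417] [cite: GlimmJaffeQP1987, Prop. 8.3.1, Cor. 8.3.2] -/
theorem integral_wick4_wick4_bil (hw : 0 < w) (hm : 0 < m2) (y y' u v : Site P j)
    (M : EuclideanSpace ℝ (Fin N) →L[ℝ] EuclideanSpace ℝ (Fin N)) :
    ∫ φ, weight C η w c m2 (0 : VecField P j ℝ) φ * (wick4 w c m2 y φ * (wick4 w c m2 y' φ * ⟪φ u, M (φ v)⟫_ℝ)) =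
      (∫ φ, weight C η w c m2 (0 : VecField P j ℝ) φ) * (8 * (N * (N + 2)) * G w c m2 y' y ^ 4 * (G w c m2 u v * trE M)
        + 32 * (N + 2) * G w c m2 y' y ^ 3 * trE M * (G w c m2 u y * G w c m2 y' v + G w c m2 v y * G w c m2 y' u)) := by
  -- BRICK 1's contraction chain of `:∣φ(y′)∣⁴:` along `h_{y,i}, h_{y,i}, h_{y,k}, h_{y,k}` (and the mixed orders)
  set W1 : Fin N → Cfg P j N → ℝ := fun i φ =>
    4 * G w c m2 y' y * (⟪φ y', (EuclideanSpace.basisFun (Fin N) ℝ) i⟫_ℝ * (‖φ y'‖ ^ 2 - (N + 2) * G w c m2 y' y')) with hW1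
  set W2 : Fin N → Cfg P j N → ℝ := fun i φ =>
    4 * G w c m2 y' y ^ 2 * ((‖φ y'‖ ^ 2 - (N + 2) * G w c m2 y' y') + 2 * (⟪φ y', (EuclideanSpace.basisFun (Fin N) ℝ) i⟫_ℝ * ⟪φ y', (EuclideanSpace.basisFun (Fin N) ℝ) i⟫_ℝ)) with hW2
  set W3 : Fin N → Fin N → Cfg P j N → ℝ := fun i k φ =>
    8 * G w c m2 y' y ^ 3 * (⟪φ y', (EuclideanSpace.basisFun (Fin N) ℝ) k⟫_ℝ + 2 * ⟪(EuclideanSpace.basisFun (Fin N) ℝ) k, (EuclideanSpace.basisFun (Fin N) ℝ) i⟫_ℝ * ⟪φ y', (EuclideanSpace.basisFun (Fin N) ℝ) i⟫_ℝ) with hW3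
  set W1k : Fin N → Fin N → Cfg P j N → ℝ := fun i k φ =>
    4 * G w c m2 y' y ^ 2 * (⟪(EuclideanSpace.basisFun (Fin N) ℝ) k, (EuclideanSpace.basisFun (Fin N) ℝ) i⟫_ℝ * (‖φ y'‖ ^ 2 - (N + 2) * G w c m2 y' y')
      + 2 * (⟪φ y', (EuclideanSpace.basisFun (Fin N) ℝ) i⟫_ℝ * ⟪φ y', (EuclideanSpace.basisFun (Fin N) ℝ) k⟫_ℝ)) with hW1k
  set W1kk : Fin N → Fin N → Cfg P j N → ℝ := fun i k φ =>
    8 * G w c m2 y' y ^ 3 * (2 * ⟪(EuclideanSpace.basisFun (Fin N) ℝ) k, (EuclideanSpace.basisFun (Fin N) ℝ) i⟫_ℝ * ⟪φ y', (EuclideanSpace.basisFun (Fin N) ℝ) k⟫_ℝ + ⟪φ y', (EuclideanSpace.basisFun (Fin N) ℝ) i⟫_ℝ) with hW1kk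
  -- the bilinear and its two derivatives along `h_{y,i}`, `h_{y,k}` (the second one a constant)
  set B1 : Fin N → Cfg P j N → ℝ := fun i φ =>
    G w c m2 u y * ⟪φ v, ContinuousLinearMap.adjoint M ((EuclideanSpace.basisFun (Fin N) ℝ) i)⟫_ℝ + G w c m2 v y * ⟪φ u, M ((EuclideanSpace.basisFun (Fin N) ℝ) i)⟫_ℝ with hB1
  set B2 : Fin N → Fin N → ℝ := fun i k =>
    G w c m2 u y * (G w c m2 v y * ⟪(EuclideanSpace.basisFun (Fin N) ℝ) k, ContinuousLinearMap.adjoint M ((EuclideanSpace.basisFun (Fin N) ℝ) i)⟫_ℝ)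
      + G w c m2 v y * (G w c m2 u y * ⟪(EuclideanSpace.basisFun (Fin N) ℝ) k, M ((EuclideanSpace.basisFun (Fin N) ℝ) i)⟫_ℝ) with hB2
  -- the Leibniz chain `R → R₁ → R₂ → R₃ → R₄` of `R = :∣φ(y′)∣⁴:·B` (collected)
  set R1 : Fin N → Cfg P j N → ℝ := fun i φ => W1 i φ * ⟪φ u, M (φ v)⟫_ℝ + wick4 w c m2 y' φ * B1 i φ with hR1
  set R2 : Fin N → Cfg P j N → ℝ := fun i φ =>
    W2 i φ * ⟪φ u, M (φ v)⟫_ℝ + 2 * (W1 i φ * B1 i φ) + B2 i i * wick4 w c m2 y' φ with hR2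
  set R3 : Fin N → Fin N → Cfg P j N → ℝ := fun i k φ =>
    W3 i k φ * ⟪φ u, M (φ v)⟫_ℝ + W2 i φ * B1 k φ + 2 * (W1k i k φ * B1 i φ) + 2 * (B2 i k * W1 i φ)
      + B2 i i * W1 k φ with hR3
  set R4 : Fin N → Fin N → Cfg P j N → ℝ := fun i k φ =>
    8 * G w c m2 y' y ^ 4 * (1 + 2 * ⟪(EuclideanSpace.basisFun (Fin N) ℝ) k, (EuclideanSpace.basisFun (Fin N) ℝ) i⟫_ℝ ^ 2) * ⟪φ u, M (φ v)⟫_ℝ + 2 * (W3 i k φ * B1 k φ)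
      + 2 * (W1kk i k φ * B1 i φ) + (B2 k k * W2 i φ + 4 * (B2 i k * W1k i k φ) + B2 i i * W2 k φ) with hR4
  -- derivatives
  have dW0 : ∀ i, DerivAlong (hx w c m2 y i) (fun φ : Cfg P j N => wick4 w c m2 y' φ) (W1 i) := fun i =>
    derivAlong_wick4_1 w c m2 y y' i
  have dW1 : ∀ i, DerivAlong (hx w c m2 y i) (W1 i) (W2 i) := fun i => derivAlong_wick4_2 w c m2 y y' i
  have dW1k : ∀ i k, DerivAlong (hx w c m2 y k) (W1 i) (W1k i k) := fun i k => derivAlong_wick4_1k w c m2 y y' i k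
  have dW2 : ∀ i k, DerivAlong (hx w c m2 y k) (W2 i) (W3 i k) := fun i k => derivAlong_wick4_3 w c m2 y y' i k
  have dW3 : ∀ i k, DerivAlong (hx w c m2 y k) (W3 i k)
      (fun _ => 8 * G w c m2 y' y ^ 4 * (1 + 2 * ⟪(EuclideanSpace.basisFun (Fin N) ℝ) k, (EuclideanSpace.basisFun (Fin N) ℝ) i⟫_ℝ ^ 2)) := fun i k => derivAlong_wick4_4 w c m2 y y' i k
  have dW1kk : ∀ i k, DerivAlong (hx w c m2 y k) (W1k i k) (W1kk i k) := fun i k =>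
    derivAlong_wick4_1kk w c m2 y y' i k
  have dB : ∀ i, DerivAlong (hx w c m2 y i) (fun φ : Cfg P j N => ⟪φ u, M (φ v)⟫_ℝ) (B1 i) := fun i =>
    (DerivAlong.inner_op_apply (hx w c m2 y i) u v M).congr fun φ => by
      simp only [hB1]
      rw [inner_hx_left, op_hx, inner_smul_right, ContinuousLinearMap.adjoint_inner_right, real_inner_comm ((EuclideanSpace.basisFun (Fin N) ℝ) i)]
  have dB1 : ∀ i k, DerivAlong (hx w c m2 y k) (B1 i) (fun _ => B2 i k) := fun i k =>
    (((DerivAlong.inner_apply (hx w c m2 y k) v _).const_mul _).add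
      ((DerivAlong.inner_apply (hx w c m2 y k) u _).const_mul _)).congr fun φ => by
      simp only [hB2]; rw [inner_hx_left, inner_hx_left]
  have hD1 : ∀ i, DerivAlong (hx w c m2 y i) (fun φ : Cfg P j N => wick4 w c m2 y' φ * ⟪φ u, M (φ v)⟫_ℝ) (R1 i) :=
    fun i => (dW0 i).mul (dB i)
  have hD2 : ∀ i, DerivAlong (hx w c m2 y i) (R1 i) (R2 i) := fun i =>
    (((dW1 i).mul (dB i)).add ((dW0 i).mul (dB1 i i))).congr fun φ => by ring
  have hD3 : ∀ i k, DerivAlong (hx w c m2 y k) (R2 i) (R3 i k) := fun i k =>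
    ((((dW2 i k).mul (dB k)).add (((dW1k i k).mul (dB1 i k)).const_mul 2)).add
      ((dW0 k).const_mul (B2 i i))).congr fun φ => by ring
  have hD4 : ∀ i k, DerivAlong (hx w c m2 y k) (R3 i k) (R4 i k) := fun i k =>
    ((((((dW3 i k).mul (dB k)).add ((dW2 i k).mul (dB1 k k))).add (((dW1kk i k).mul (dB1 i k)).const_mul 2)).add
      (((dW1k i k).const_mul (B2 i k)).const_mul 2)).add ((dW1 k).const_mul (B2 i i))).congr fun φ => by ring
  -- growth
  have eB : ExpGrowth (fun φ : Cfg P j N => ⟪φ u, M (φ v)⟫_ℝ) := ExpGrowth.inner_op_apply u v M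
  have eW0 : ExpGrowth (fun φ : Cfg P j N => wick4 w c m2 y' φ) := expGrowth_wick4 w c m2 y'
  have eW1 : ∀ i, ExpGrowth (W1 i) := fun i =>
    ((ExpGrowth.inner_apply y' _).mul ((ExpGrowth.norm_sq_apply y').sub (ExpGrowth.const _))).const_mul _
  have eW2 : ∀ i, ExpGrowth (W2 i) := fun i =>
    (((ExpGrowth.norm_sq_apply y').sub (ExpGrowth.const _)).add
      (((ExpGrowth.inner_apply y' _).mul (ExpGrowth.inner_apply y' _)).const_mul 2)).const_mul _
  have eW3 : ∀ i k, ExpGrowth (W3 i k) := fun i k =>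
    ((ExpGrowth.inner_apply y' _).add ((ExpGrowth.inner_apply y' _).const_mul _)).const_mul _
  have eW1k : ∀ i k, ExpGrowth (W1k i k) := fun i k =>
    ((((ExpGrowth.norm_sq_apply y').sub (ExpGrowth.const _)).const_mul _).add
      (((ExpGrowth.inner_apply y' _).mul (ExpGrowth.inner_apply y' _)).const_mul 2)).const_mul _
  have eW1kk : ∀ i k, ExpGrowth (W1kk i k) := fun i k =>
    (((ExpGrowth.inner_apply y' _).const_mul _).add (ExpGrowth.inner_apply y' _)).const_mul _
  have eB1 : ∀ i, ExpGrowth (B1 i) := fun i =>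
    ((ExpGrowth.inner_apply v _).const_mul _).add ((ExpGrowth.inner_apply u _).const_mul _)
  have eR1 : ∀ i, ExpGrowth (R1 i) := fun i => ((eW1 i).mul eB).add (eW0.mul (eB1 i))
  have eR2 : ∀ i, ExpGrowth (R2 i) := fun i =>
    (((eW2 i).mul eB).add (((eW1 i).mul (eB1 i)).const_mul 2)).add (eW0.const_mul _)
  have eR3 : ∀ i k, ExpGrowth (R3 i k) := fun i k =>
    (((((eW3 i k).mul eB).add ((eW2 i).mul (eB1 k))).add (((eW1k i k).mul (eB1 i)).const_mul 2)).add
      (((eW1 i).const_mul _).const_mul 2)).add ((eW1 k).const_mul _)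
  have eR4 : ∀ i k, ExpGrowth (R4 i k) := fun i k =>
    (((eB.const_mul _).add (((eW3 i k).mul (eB1 k)).const_mul 2)).add (((eW1kk i k).mul (eB1 i)).const_mul 2)).add
      ((((eW2 i).const_mul _).add (((eW1k i k).const_mul _).const_mul 4)).add ((eW2 k).const_mul _))
  -- all four legs of the vertex at `y` contracted
  have key := integral_wick4_mul C η w c m2 hw hm y (R := fun φ : Cfg P j N => wick4 w c m2 y' φ * ⟪φ u, M (φ v)⟫_ℝ)
    (R₁ := R1) (R₂ := R2) (R₃ := R3) (R₄ := R4) (eW0.mul eB) eR1 eR2 eR3 eR4 hD1 hD2 hD3 hD4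
  rw [key]
  -- the Gaussian integrals the vertex at `y′` leaves behind
  have hZ2 : ∀ i, ∫ φ, weight C η w c m2 (0 : VecField P j ℝ) φ * W2 i φ = 0 := fun i => by
    have e : (fun φ : Cfg P j N => weight C η w c m2 (0 : VecField P j ℝ) φ * W2 i φ) = fun φ => 4 * G w c m2 y' y ^ 2 *
        (weight C η w c m2 (0 : VecField P j ℝ) φ * ((‖φ y'‖ ^ 2 - (N + 2) * G w c m2 y' y') + 2 * (⟪φ y', (EuclideanSpace.basisFun (Fin N) ℝ) i⟫_ℝ * ⟪φ y', (EuclideanSpace.basisFun (Fin N) ℝ) i⟫_ℝ))) := by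
      funext φ; simp only [hW2]; ring
    rw [e, integral_const_mul, integral_wick4_rem2' C η w c m2 hw hm y' i, mul_zero]
  have hZ1k : ∀ i k, ∫ φ, weight C η w c m2 (0 : VecField P j ℝ) φ * W1k i k φ = 0 := fun i k => by
    have e : (fun φ : Cfg P j N => weight C η w c m2 (0 : VecField P j ℝ) φ * W1k i k φ) = fun φ => 4 * G w c m2 y' y ^ 2 *
        (weight C η w c m2 (0 : VecField P j ℝ) φ * (⟪(EuclideanSpace.basisFun (Fin N) ℝ) k, (EuclideanSpace.basisFun (Fin N) ℝ) i⟫_ℝ * (‖φ y'‖ ^ 2 - (N + 2) * G w c m2 y' y') + 2 * (⟪φ y', (EuclideanSpace.basisFun (Fin N) ℝ) i⟫_ℝ * ⟪φ y', (EuclideanSpace.basisFun (Fin N) ℝ) k⟫_ℝ))) := by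
      funext φ; simp only [hW1k]; ring
    rw [e, integral_const_mul, integral_wick4_rem2 C η w c m2 hw hm y' i k, mul_zero]
  have hI2 : ∀ i k, ∫ φ, weight C η w c m2 (0 : VecField P j ℝ) φ * (W3 i k φ * B1 k φ) = 8 * G w c m2 y' y ^ 3 *
      ∫ φ, weight C η w c m2 (0 : VecField P j ℝ) φ * ((1 * ⟪φ y', (EuclideanSpace.basisFun (Fin N) ℝ) k⟫_ℝ + (2 * ⟪(EuclideanSpace.basisFun (Fin N) ℝ) k, (EuclideanSpace.basisFun (Fin N) ℝ) i⟫_ℝ) * ⟪φ y', (EuclideanSpace.basisFun (Fin N) ℝ) i⟫_ℝ) *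
        (G w c m2 u y * ⟪φ v, ContinuousLinearMap.adjoint M ((EuclideanSpace.basisFun (Fin N) ℝ) k)⟫_ℝ + G w c m2 v y * ⟪φ u, M ((EuclideanSpace.basisFun (Fin N) ℝ) k)⟫_ℝ)) := fun i k => by
    rw [← integral_const_mul]
    exact integral_congr_ae (Filter.Eventually.of_forall fun φ => by simp only [hW3, hB1]; ring)
  have hI3 : ∀ i k, ∫ φ, weight C η w c m2 (0 : VecField P j ℝ) φ * (W1kk i k φ * B1 i φ) = 8 * G w c m2 y' y ^ 3 *
      ∫ φ, weight C η w c m2 (0 : VecField P j ℝ) φ * (((2 * ⟪(EuclideanSpace.basisFun (Fin N) ℝ) k, (EuclideanSpace.basisFun (Fin N) ℝ) i⟫_ℝ) * ⟪φ y', (EuclideanSpace.basisFun (Fin N) ℝ) k⟫_ℝ + 1 * ⟪φ y', (EuclideanSpace.basisFun (Fin N) ℝ) i⟫_ℝ) *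
        (G w c m2 u y * ⟪φ v, ContinuousLinearMap.adjoint M ((EuclideanSpace.basisFun (Fin N) ℝ) i)⟫_ℝ + G w c m2 v y * ⟪φ u, M ((EuclideanSpace.basisFun (Fin N) ℝ) i)⟫_ℝ)) := fun i k => by
    rw [← integral_const_mul]
    exact integral_congr_ae (Filter.Eventually.of_forall fun φ => by simp only [hW1kk, hB1]; ring)
  have hIk : ∀ i k, ∫ φ, weight C η w c m2 (0 : VecField P j ℝ) φ * R4 i k φ = (∫ φ, weight C η w c m2 (0 : VecField P j ℝ) φ) *
      (8 * G w c m2 y' y ^ 4 * (1 + 2 * ⟪(EuclideanSpace.basisFun (Fin N) ℝ) k, (EuclideanSpace.basisFun (Fin N) ℝ) i⟫_ℝ ^ 2) * (G w c m2 u v * trE M)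
        + 16 * G w c m2 y' y ^ 3 * (G w c m2 u y * G w c m2 y' v + G w c m2 v y * G w c m2 y' u) *
          (⟪(EuclideanSpace.basisFun (Fin N) ℝ) k, M ((EuclideanSpace.basisFun (Fin N) ℝ) k)⟫_ℝ + ⟪(EuclideanSpace.basisFun (Fin N) ℝ) i, M ((EuclideanSpace.basisFun (Fin N) ℝ) i)⟫_ℝ + 2 * ⟪(EuclideanSpace.basisFun (Fin N) ℝ) k, (EuclideanSpace.basisFun (Fin N) ℝ) i⟫_ℝ * (⟪(EuclideanSpace.basisFun (Fin N) ℝ) k, M ((EuclideanSpace.basisFun (Fin N) ℝ) i)⟫_ℝ + ⟪(EuclideanSpace.basisFun (Fin N) ℝ) i, M ((EuclideanSpace.basisFun (Fin N) ℝ) k)⟫_ℝ))) := by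
    intro i k
    have jB := eB.integrable C η w c m2 hw hm
    have j2 := ((eW3 i k).mul (eB1 k)).integrable C η w c m2 hw hm
    have j3 := ((eW1kk i k).mul (eB1 i)).integrable C η w c m2 hw hm
    have j4 := (eW2 i).integrable C η w c m2 hw hm
    have j5 := (eW1k i k).integrable C η w c m2 hw hm
    have j6 := (eW2 k).integrable C η w c m2 hw hm
    have e : (fun φ : Cfg P j N => weight C η w c m2 (0 : VecField P j ℝ) φ * R4 i k φ) = fun φ =>
        8 * G w c m2 y' y ^ 4 * (1 + 2 * ⟪(EuclideanSpace.basisFun (Fin N) ℝ) k, (EuclideanSpace.basisFun (Fin N) ℝ) i⟫_ℝ ^ 2) * (weight C η w c m2 (0 : VecField P j ℝ) φ * ⟪φ u, M (φ v)⟫_ℝ)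
          + 2 * (weight C η w c m2 (0 : VecField P j ℝ) φ * (W3 i k φ * B1 k φ)) + 2 * (weight C η w c m2 (0 : VecField P j ℝ) φ * (W1kk i k φ * B1 i φ))
          + (B2 k k * (weight C η w c m2 (0 : VecField P j ℝ) φ * W2 i φ) + 4 * B2 i k * (weight C η w c m2 (0 : VecField P j ℝ) φ * W1k i k φ) + B2 i i * (weight C η w c m2 (0 : VecField P j ℝ) φ * W2 k φ)) := by
      funext φ; simp only [hR4]; ring
    have j12 : Integrable (fun φ : Cfg P j N =>
        8 * G w c m2 y' y ^ 4 * (1 + 2 * ⟪(EuclideanSpace.basisFun (Fin N) ℝ) k, (EuclideanSpace.basisFun (Fin N) ℝ) i⟫_ℝ ^ 2) * (weight C η w c m2 (0 : VecField P j ℝ) φ * ⟪φ u, M (φ v)⟫_ℝ)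
          + 2 * (weight C η w c m2 (0 : VecField P j ℝ) φ * (W3 i k φ * B1 k φ))) := (jB.const_mul _).add (j2.const_mul _)
    have j123 : Integrable (fun φ : Cfg P j N =>
        8 * G w c m2 y' y ^ 4 * (1 + 2 * ⟪(EuclideanSpace.basisFun (Fin N) ℝ) k, (EuclideanSpace.basisFun (Fin N) ℝ) i⟫_ℝ ^ 2) * (weight C η w c m2 (0 : VecField P j ℝ) φ * ⟪φ u, M (φ v)⟫_ℝ)
          + 2 * (weight C η w c m2 (0 : VecField P j ℝ) φ * (W3 i k φ * B1 k φ)) + 2 * (weight C η w c m2 (0 : VecField P j ℝ) φ * (W1kk i k φ * B1 i φ))) := j12.add (j3.const_mul _)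
    have j45 : Integrable (fun φ : Cfg P j N =>
        B2 k k * (weight C η w c m2 (0 : VecField P j ℝ) φ * W2 i φ) + 4 * B2 i k * (weight C η w c m2 (0 : VecField P j ℝ) φ * W1k i k φ)) := (j4.const_mul _).add (j5.const_mul _)
    have j456 : Integrable (fun φ : Cfg P j N =>
        B2 k k * (weight C η w c m2 (0 : VecField P j ℝ) φ * W2 i φ) + 4 * B2 i k * (weight C η w c m2 (0 : VecField P j ℝ) φ * W1k i k φ) + B2 i i * (weight C η w c m2 (0 : VecField P j ℝ) φ * W2 k φ)) :=
      j45.add (j6.const_mul _)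
    rw [e, integral_add j123 j456, integral_add j12 (j3.const_mul _), integral_add (jB.const_mul _) (j2.const_mul _),
      integral_add j45 (j6.const_mul _), integral_add (j4.const_mul _) (j5.const_mul _),
      integral_const_mul, integral_const_mul, integral_const_mul, integral_const_mul, integral_const_mul,
      integral_const_mul, moment2_op C η w c m2 hw hm u v M, hI2, hI3, hZ2 i, hZ1k i k, hZ2 k,
      integral_lin_lin C η w c m2 hw hm y' v u ((EuclideanSpace.basisFun (Fin N) ℝ) k) ((EuclideanSpace.basisFun (Fin N) ℝ) i) _ _ _ _ _ _,
      integral_lin_lin C η w c m2 hw hm y' v u ((EuclideanSpace.basisFun (Fin N) ℝ) k) ((EuclideanSpace.basisFun (Fin N) ℝ) i) _ _ _ _ _ _]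
    simp only [inner_adjoint_basis, mul_zero, add_zero]
    ring
  simp_rw [hIk]
  have e2 : ∀ i k : Fin N, (∫ φ, weight C η w c m2 (0 : VecField P j ℝ) φ) *
      (8 * G w c m2 y' y ^ 4 * (1 + 2 * ⟪(EuclideanSpace.basisFun (Fin N) ℝ) k, (EuclideanSpace.basisFun (Fin N) ℝ) i⟫_ℝ ^ 2) * (G w c m2 u v * trE M)
        + 16 * G w c m2 y' y ^ 3 * (G w c m2 u y * G w c m2 y' v + G w c m2 v y * G w c m2 y' u) *
          (⟪(EuclideanSpace.basisFun (Fin N) ℝ) k, M ((EuclideanSpace.basisFun (Fin N) ℝ) k)⟫_ℝ + ⟪(EuclideanSpace.basisFun (Fin N) ℝ) i, M ((EuclideanSpace.basisFun (Fin N) ℝ) i)⟫_ℝ + 2 * ⟪(EuclideanSpace.basisFun (Fin N) ℝ) k, (EuclideanSpace.basisFun (Fin N) ℝ) i⟫_ℝ * (⟪(EuclideanSpace.basisFun (Fin N) ℝ) k, M ((EuclideanSpace.basisFun (Fin N) ℝ) i)⟫_ℝ + ⟪(EuclideanSpace.basisFun (Fin N) ℝ) i, M ((EuclideanSpace.basisFun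 (Fin N) ℝ) k)⟫_ℝ))) =
      ((∫ φ, weight C η w c m2 (0 : VecField P j ℝ) φ) * (8 * G w c m2 y' y ^ 4 * (G w c m2 u v * trE M))) * (1 + 2 * ⟪(EuclideanSpace.basisFun (Fin N) ℝ) k, (EuclideanSpace.basisFun (Fin N) ℝ) i⟫_ℝ ^ 2)
        + ((∫ φ, weight C η w c m2 (0 : VecField P j ℝ) φ) * (16 * G w c m2 y' y ^ 3 * (G w c m2 u y * G w c m2 y' v + G w c m2 v y * G w c m2 y' u))) *
          (⟪(EuclideanSpace.basisFun (Fin N) ℝ) k, M ((EuclideanSpace.basisFun (Fin N) ℝ) k)⟫_ℝ + ⟪(EuclideanSpace.basisFun (Fin N) ℝ) i, M ((EuclideanSpace.basisFun (Fin N) ℝ) i)⟫_ℝ + 2 * ⟪(EuclideanSpace.basisFun (Fin N) ℝ) k, (EuclideanSpace.basisFun (Fin N) ℝ) i⟫_ℝ * (⟪(EuclideanSpace.basisFun (Fin N) ℝ) k, M ((EuclideanSpace.basisFun (Fin N) ℝ) i)⟫_ℝ + ⟪(EuclideanSpace.basisFun (Fin N) ℝ) i, M ((EuclideanSpace.basisFun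 (Fin N) ℝ) k)⟫_ℝ)) :=
    fun i k => by ring
  have sum1 : ∑ i : Fin N, ∑ k : Fin N, (1 + 2 * ⟪(EuclideanSpace.basisFun (Fin N) ℝ) k, (EuclideanSpace.basisFun (Fin N) ℝ) i⟫_ℝ ^ 2) = (N : ℝ) * N + 2 * N := by
    have h1 : ∀ i : Fin N, ∑ k : Fin N, (1 + 2 * ⟪(EuclideanSpace.basisFun (Fin N) ℝ) k, (EuclideanSpace.basisFun (Fin N) ℝ) i⟫_ℝ ^ 2) = N + 2 * ∑ k : Fin N, ⟪(EuclideanSpace.basisFun (Fin N) ℝ) k, (EuclideanSpace.basisFun (Fin N) ℝ) i⟫_ℝ ^ 2 :=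
      fun i => by
      rw [Finset.sum_add_distrib, Finset.sum_const, Finset.card_univ, Fintype.card_fin, nsmul_eq_mul, mul_one,
        Finset.mul_sum]
    simp_rw [h1]
    rw [Finset.sum_add_distrib, Finset.sum_const, Finset.card_univ, Fintype.card_fin, nsmul_eq_mul, ← Finset.mul_sum,
      sum_sum_inner_basis_sq]
  have sum2 : ∑ i : Fin N, ∑ k : Fin N,
      (⟪(EuclideanSpace.basisFun (Fin N) ℝ) k, M ((EuclideanSpace.basisFun (Fin N) ℝ) k)⟫_ℝ + ⟪(EuclideanSpace.basisFun (Fin N) ℝ) i, M ((EuclideanSpace.basisFun (Fin N) ℝ) i)⟫_ℝ + 2 * ⟪(EuclideanSpace.basisFun (Fin N) ℝ) k, (EuclideanSpace.basisFun (Fin N) ℝ) i⟫_ℝ * (⟪(EuclideanSpace.basisFun (Fin N) ℝ) k, M ((EuclideanSpace.basisFun (Fin N) ℝ) i)⟫_ℝ + ⟪(EuclideanSpace.basisFun (Fin N) ℝ) i, M ((EuclideanSpace.basisFun (Fin N) ℝ) k)⟫_ℝ)) =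
      (2 * N + 4) * trE M := by
    have t0 : ∑ k : Fin N, ⟪(EuclideanSpace.basisFun (Fin N) ℝ) k, M ((EuclideanSpace.basisFun (Fin N) ℝ) k)⟫_ℝ = trE M := rfl
    have h1 : ∀ i : Fin N, ∑ k : Fin N,
        (⟪(EuclideanSpace.basisFun (Fin N) ℝ) k, M ((EuclideanSpace.basisFun (Fin N) ℝ) k)⟫_ℝ + ⟪(EuclideanSpace.basisFun (Fin N) ℝ) i, M ((EuclideanSpace.basisFun (Fin N) ℝ) i)⟫_ℝ + 2 * ⟪(EuclideanSpace.basisFun (Fin N) ℝ) k, (EuclideanSpace.basisFun (Fin N) ℝ) i⟫_ℝ * (⟪(EuclideanSpace.basisFun (Fin N) ℝ) k, M ((EuclideanSpace.basisFun (Fin N) ℝ) i)⟫_ℝ + ⟪(EuclideanSpace.basisFun (Fin N) ℝ) i, M ((EuclideanSpace.basisFun (Fin N) ℝ) k)⟫_ℝ)) =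
        trE M + N * ⟪(EuclideanSpace.basisFun (Fin N) ℝ) i, M ((EuclideanSpace.basisFun (Fin N) ℝ) i)⟫_ℝ + 4 * ⟪(EuclideanSpace.basisFun (Fin N) ℝ) i, M ((EuclideanSpace.basisFun (Fin N) ℝ) i)⟫_ℝ := by
      intro i
      have t3 : ∑ k : Fin N, 2 * ⟪(EuclideanSpace.basisFun (Fin N) ℝ) k, (EuclideanSpace.basisFun (Fin N) ℝ) i⟫_ℝ * (⟪(EuclideanSpace.basisFun (Fin N) ℝ) k, M ((EuclideanSpace.basisFun (Fin N) ℝ) i)⟫_ℝ + ⟪(EuclideanSpace.basisFun (Fin N) ℝ) i, M ((EuclideanSpace.basisFun (Fin N) ℝ) k)⟫_ℝ) = 4 * ⟪(EuclideanSpace.basisFun (Fin N) ℝ) i, M ((EuclideanSpace.basisFun (Fin N) ℝ) i)⟫_ℝ := by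
        rw [Finset.sum_eq_single i (fun k _ hk => by rw [inner_basis, if_neg hk]; ring)
          (fun h => absurd (Finset.mem_univ i) h), inner_basis, if_pos rfl]
        ring
      rw [Finset.sum_add_distrib, Finset.sum_add_distrib, t0, t3, Finset.sum_const, Finset.card_univ, Fintype.card_fin,
        nsmul_eq_mul]
    simp_rw [h1]
    rw [Finset.sum_add_distrib, Finset.sum_add_distrib, Finset.sum_const, Finset.card_univ, Fintype.card_fin,
      nsmul_eq_mul, ← Finset.mul_sum, ← Finset.mul_sum]
    have t1 : ∑ i : Fin N, ⟪(EuclideanSpace.basisFun (Fin N) ℝ) i, M ((EuclideanSpace.basisFun (Fin N) ℝ) i)⟫_ℝ = trE M := rfl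
    rw [t1]
    ring
  simp_rw [e2, Finset.sum_add_distrib, ← Finset.mul_sum]
  rw [sum1, sum2]
  ring

/-! ## §3 SUMMED OVER THE TWO VERTICES: the bilinear insertion against `V_:² = (Σ_yη^d:∣φ(y)∣⁴:)²`, and its connected part -/

/-- **`∫W₀·⟪φ(u),Mφ(v)⟫·V_:² = Z₀·Σ_{y,y′}η^{2d}[8N(N+2)C₀(y′,y)⁴·C₀(u,v)tr M + 32(N+2)tr M·C₀(y′,y)³(C₀(u,y)C₀(y′,v) +
C₀(v,y)C₀(y′,u))]`** for `V_: = Σ_yη^d:∣φ(y)∣⁴:` (§2 summed over the two vertices) — BRICK 1's `integral_sumWick4_sq_legs` (the two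
external legs) generalised to an arbitrary bilinear vertex. [cite: Balaban1983Higgs3, (1.24) p.417; (1.22) p.416]
[cite: GlimmJaffeQP1987, Prop. 8.3.1, Cor. 8.3.2] -/
theorem integral_bil_sumWick4_sq (hw : 0 < w) (hm : 0 < m2) (u v : Site P j)
    (M : EuclideanSpace ℝ (Fin N) →L[ℝ] EuclideanSpace ℝ (Fin N)) :
    ∫ φ, weight C η w c m2 (0 : VecField P j ℝ) φ * (⟪φ u, M (φ v)⟫_ℝ *
        ((∑ y : Site P j, w * wick4 w c m2 y φ) * (∑ y : Site P j, w * wick4 w c m2 y φ))) =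
      (∫ φ, weight C η w c m2 (0 : VecField P j ℝ) φ) * ∑ y : Site P j, ∑ y' : Site P j, w * w *
        (8 * (N * (N + 2)) * G w c m2 y' y ^ 4 * (G w c m2 u v * trE M)
          + 32 * (N + 2) * G w c m2 y' y ^ 3 * trE M * (G w c m2 u y * G w c m2 y' v + G w c m2 v y * G w c m2 y' u)) := by
  have hi : ∀ y y' : Site P j, Integrable (fun φ : Cfg P j N =>
      weight C η w c m2 (0 : VecField P j ℝ) φ * (w * w * (wick4 w c m2 y φ * (wick4 w c m2 y' φ * ⟪φ u, M (φ v)⟫_ℝ)))) := fun y y' =>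
    (((expGrowth_wick4 w c m2 y).mul ((expGrowth_wick4 w c m2 y').mul (ExpGrowth.inner_op_apply u v M))).const_mul
      (w * w)).integrable C η w c m2 hw hm
  have e1 : (fun φ : Cfg P j N => weight C η w c m2 (0 : VecField P j ℝ) φ * (⟪φ u, M (φ v)⟫_ℝ *
        ((∑ y : Site P j, w * wick4 w c m2 y φ) * (∑ y : Site P j, w * wick4 w c m2 y φ))))
      = fun φ => ∑ y : Site P j, ∑ y' : Site P j,
          weight C η w c m2 (0 : VecField P j ℝ) φ * (w * w * (wick4 w c m2 y φ * (wick4 w c m2 y' φ * ⟪φ u, M (φ v)⟫_ℝ))) := by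
    funext φ
    rw [Finset.sum_mul_sum, Finset.mul_sum, Finset.mul_sum]
    refine Finset.sum_congr rfl fun y _ => ?_
    rw [Finset.mul_sum, Finset.mul_sum]
    exact Finset.sum_congr rfl fun y' _ => by ring
  rw [e1, integral_finsetSum _ (fun y _ => integrable_finsetSum _ fun y' _ => hi y y'), Finset.mul_sum]
  refine Finset.sum_congr rfl fun y _ => ?_
  rw [integral_finsetSum _ (fun y' _ => hi y y'), Finset.mul_sum]
  refine Finset.sum_congr rfl fun y' _ => ?_
  have e2 : (fun φ : Cfg P j N => weight C η w c m2 (0 : VecField P j ℝ) φ * (w * w * (wick4 w c m2 y φ * (wick4 w c m2 y' φ * ⟪φ u, M (φ v)⟫_ℝ))))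
      = fun φ => (w * w) * (weight C η w c m2 (0 : VecField P j ℝ) φ * (wick4 w c m2 y φ * (wick4 w c m2 y' φ * ⟪φ u, M (φ v)⟫_ℝ))) := by
    funext φ; ring
  rw [e2, integral_const_mul, integral_wick4_wick4_bil C η w c m2 hw hm y y' u v M]
  ring

/-- **THE SUNSET WITH ONE DRESSED LINE, CONNECTED**: `[∫W₀(⟪φ(u),Mφ(v)⟫·V_:²)·Z₀ − ∫W₀V_:²·∫W₀⟪φ(u),Mφ(v)⟫]/Z₀² =
Σ_{y,y′}η^{2d}·32(N+2)tr M·C₀(y′,y)³·(C₀(u,y)C₀(y′,v) + C₀(v,y)C₀(y′,u))` — the basketball times the loop of the insertion cancels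
(BRICK 1 `integral_sumWick4_sq`, `B3WTCovariance.moment2_op`).  Since `⟨V_:⟩₀ = 0` and a bilinear cannot close a graph with one
Wick-ordered quartic vertex (`Cov₀(B,V_:) = 0`), this is the joint cumulant `κ₃(B; V_:, V_:)` in which BRICK 17
`B3Eq124IndexTwoTwo` §10 leaves the `(2,2)` term, for a bilinear insertion `B` (print's ② with `M = q²`, `(u,v) = (b₋,b₊)`; the mass
vertex with `M = 1`, `u = v`; the ④ part of `Y` is quartic and not covered here). [cite: Balaban1983Higgs3, (1.24) p.417; (1.22)–(1.23)
pp.416–417] [cite: GlimmJaffeQP1987, Cor. 8.3.2, §8.5] -/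
theorem cum3_bil_sumWick4_sq (hw : 0 < w) (hm : 0 < m2) (u v : Site P j)
    (M : EuclideanSpace ℝ (Fin N) →L[ℝ] EuclideanSpace ℝ (Fin N)) :
    ((∫ φ, weight C η w c m2 (0 : VecField P j ℝ) φ * (⟪φ u, M (φ v)⟫_ℝ *
          ((∑ y : Site P j, w * wick4 w c m2 y φ) * (∑ y : Site P j, w * wick4 w c m2 y φ)))) * (∫ φ, weight C η w c m2 (0 : VecField P j ℝ) φ)
        - (∫ φ, weight C η w c m2 (0 : VecField P j ℝ) φ * ((∑ y : Site P j, w * wick4 w c m2 y φ) * (∑ y : Site P j, w * wick4 w c m2 y φ))) *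
          (∫ φ, weight C η w c m2 (0 : VecField P j ℝ) φ * ⟪φ u, M (φ v)⟫_ℝ)) / (∫ φ, weight C η w c m2 (0 : VecField P j ℝ) φ) ^ 2 =
      ∑ y : Site P j, ∑ y' : Site P j, w * w *
        (32 * (N + 2) * G w c m2 y' y ^ 3 * trE M * (G w c m2 u y * G w c m2 y' v + G w c m2 v y * G w c m2 y' u)) := by
  have hZ : (∫ φ, weight C η w c m2 (0 : VecField P j ℝ) φ) ≠ 0 := (B3WT226Traces.Z_pos C η w c m2 hw hm).ne'
  have hVV : ∫ φ, weight C η w c m2 (0 : VecField P j ℝ) φ * ((∑ y : Site P j, w * wick4 w c m2 y φ) * (∑ y : Site P j, w * wick4 w c m2 y φ)) =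
      (∫ φ, weight C η w c m2 (0 : VecField P j ℝ) φ) * ∑ y : Site P j, ∑ z : Site P j, w * w * (8 * (N * (N + 2)) * G w c m2 z y ^ 4) := by
    rw [← integral_sumWick4_sq C η w c m2 hw hm]
    exact integral_congr_ae (Filter.Eventually.of_forall fun φ => by ring)
  have hsplit : ∑ y : Site P j, ∑ y' : Site P j, w * w *
        (8 * (N * (N + 2)) * G w c m2 y' y ^ 4 * (G w c m2 u v * trE M)
          + 32 * (N + 2) * G w c m2 y' y ^ 3 * trE M * (G w c m2 u y * G w c m2 y' v + G w c m2 v y * G w c m2 y' u))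
      = (∑ y : Site P j, ∑ y' : Site P j, w * w * (8 * (N * (N + 2)) * G w c m2 y' y ^ 4)) * (G w c m2 u v * trE M)
        + ∑ y : Site P j, ∑ y' : Site P j, w * w *
          (32 * (N + 2) * G w c m2 y' y ^ 3 * trE M * (G w c m2 u y * G w c m2 y' v + G w c m2 v y * G w c m2 y' u)) := by
    rw [Finset.sum_mul, ← Finset.sum_add_distrib]
    refine Finset.sum_congr rfl fun y _ => ?_
    rw [Finset.sum_mul, ← Finset.sum_add_distrib]
    exact Finset.sum_congr rfl fun y' _ => by ring
  rw [integral_bil_sumWick4_sq C η w c m2 hw hm u v M, hVV, moment2_op C η w c m2 hw hm u v M, hsplit,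
    div_eq_iff (pow_ne_zero 2 hZ)]
  ring

/-! ## §4 THE MASS COUNTERTERM VERTEX ON A SUNSET LINE: the insertion `Q = Σ_zη^d∣φ(z)∣²` (`M = 1`, `u = v = z`) -/

omit C η w c m2 in
/-- `tr 1 = N`. [folklore] -/
private theorem trE_one : trE (1 : EuclideanSpace ℝ (Fin N) →L[ℝ] EuclideanSpace ℝ (Fin N)) = N := by
  unfold trE
  simp only [one_apply_eq_self, (EuclideanSpace.basisFun (Fin N) ℝ).orthonormal.1, real_inner_self_eq_norm_sq,
    one_pow, Finset.sum_const, Finset.card_univ, Fintype.card_fin, nsmul_eq_mul, mul_one]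

/-- **THE MASS VERTEX ON A SUNSET LINE, CONNECTED**: for `Q = Σ_zη^d∣φ(z)∣²` (the counterterm vertex (1.7) per unit `−δm²`),
`[∫W₀(Q·V_:²)·Z₀ − ∫W₀V_:²·∫W₀Q]/Z₀² = Σ_zη^d Σ_{y,y′}η^{2d}·64N(N+2)·C₀(y′,y)³·C₀(z,y)C₀(y′,z)` — §3 with `M = 1`, `u = v = z`
(`tr 1 = N`), summed over the vertex `z`: the joint cumulant `κ₃(Q; V_:, V_:)`, i.e. the `−δm²_{(2,0)}Q` part of BRICK 17's
`κ₃(Y; V_:, V_:)` per unit `−δm²_{(2,0)}`. [cite: Balaban1983Higgs3, (1.23)–(1.24) p.417; (1.7) p.413]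
[cite: GlimmJaffeQP1987, Cor. 8.3.2, §8.5] -/
theorem cum3_massForm_sumWick4_sq (hw : 0 < w) (hm : 0 < m2) :
    ((∫ φ, weight C η w c m2 (0 : VecField P j ℝ) φ * (massForm w φ *
          ((∑ y : Site P j, w * wick4 w c m2 y φ) * (∑ y : Site P j, w * wick4 w c m2 y φ)))) * (∫ φ, weight C η w c m2 (0 : VecField P j ℝ) φ)
        - (∫ φ, weight C η w c m2 (0 : VecField P j ℝ) φ * ((∑ y : Site P j, w * wick4 w c m2 y φ) * (∑ y : Site P j, w * wick4 w c m2 y φ))) *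
          (∫ φ, weight C η w c m2 (0 : VecField P j ℝ) φ * massForm w φ)) / (∫ φ, weight C η w c m2 (0 : VecField P j ℝ) φ) ^ 2 =
      ∑ z : Site P j, w * ∑ y : Site P j, ∑ y' : Site P j, w * w *
        (64 * (N * (N + 2)) * G w c m2 y' y ^ 3 * (G w c m2 z y * G w c m2 y' z)) := by
  have hq : ∀ (z : Site P j) (φ : Cfg P j N), ‖φ z‖ ^ 2 =
      ⟪φ z, (1 : EuclideanSpace ℝ (Fin N) →L[ℝ] EuclideanSpace ℝ (Fin N)) (φ z)⟫_ℝ := fun z φ => by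
    rw [one_apply_eq_self, real_inner_self_eq_norm_sq]
  have eV : ExpGrowth (fun φ : Cfg P j N => ∑ y : Site P j, w * wick4 w c m2 y φ) := expGrowth_sum_wick4 w c m2
  -- the two integrals containing `Q`, split over the vertex `z`
  have hA : ∫ φ, weight C η w c m2 (0 : VecField P j ℝ) φ * (massForm w φ *
        ((∑ y : Site P j, w * wick4 w c m2 y φ) * (∑ y : Site P j, w * wick4 w c m2 y φ))) =
      ∑ z : Site P j, w * ∫ φ, weight C η w c m2 (0 : VecField P j ℝ) φ *
        (⟪φ z, (1 : EuclideanSpace ℝ (Fin N) →L[ℝ] EuclideanSpace ℝ (Fin N)) (φ z)⟫_ℝ *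
          ((∑ y : Site P j, w * wick4 w c m2 y φ) * (∑ y : Site P j, w * wick4 w c m2 y φ))) := by
    have hi : ∀ z : Site P j, Integrable (fun φ : Cfg P j N => weight C η w c m2 (0 : VecField P j ℝ) φ *
        (w * (⟪φ z, (1 : EuclideanSpace ℝ (Fin N) →L[ℝ] EuclideanSpace ℝ (Fin N)) (φ z)⟫_ℝ *
          ((∑ y : Site P j, w * wick4 w c m2 y φ) * (∑ y : Site P j, w * wick4 w c m2 y φ))))) := fun z =>
      (((ExpGrowth.inner_op_apply z z _).mul (eV.mul eV)).const_mul w).integrable C η w c m2 hw hm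
    have e : (fun φ : Cfg P j N => weight C η w c m2 (0 : VecField P j ℝ) φ * (massForm w φ *
        ((∑ y : Site P j, w * wick4 w c m2 y φ) * (∑ y : Site P j, w * wick4 w c m2 y φ)))) = fun φ =>
        ∑ z : Site P j, weight C η w c m2 (0 : VecField P j ℝ) φ *
          (w * (⟪φ z, (1 : EuclideanSpace ℝ (Fin N) →L[ℝ] EuclideanSpace ℝ (Fin N)) (φ z)⟫_ℝ *
            ((∑ y : Site P j, w * wick4 w c m2 y φ) * (∑ y : Site P j, w * wick4 w c m2 y φ)))) := by
      funext φ
      rw [massForm, Finset.sum_mul, Finset.mul_sum]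
      exact Finset.sum_congr rfl fun z _ => by rw [hq z φ]; ring
    rw [e, integral_finsetSum _ (fun z _ => hi z)]
    refine Finset.sum_congr rfl fun z _ => ?_
    rw [← integral_const_mul]
    exact integral_congr_ae (Filter.Eventually.of_forall fun φ => by ring)
  have hB : ∫ φ, weight C η w c m2 (0 : VecField P j ℝ) φ * massForm w φ =
      ∑ z : Site P j, w * ∫ φ, weight C η w c m2 (0 : VecField P j ℝ) φ *
        ⟪φ z, (1 : EuclideanSpace ℝ (Fin N) →L[ℝ] EuclideanSpace ℝ (Fin N)) (φ z)⟫_ℝ := by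
    have hi : ∀ z : Site P j, Integrable (fun φ : Cfg P j N => weight C η w c m2 (0 : VecField P j ℝ) φ *
        (w * ⟪φ z, (1 : EuclideanSpace ℝ (Fin N) →L[ℝ] EuclideanSpace ℝ (Fin N)) (φ z)⟫_ℝ)) := fun z =>
      ((ExpGrowth.inner_op_apply z z _).const_mul w).integrable C η w c m2 hw hm
    have e : (fun φ : Cfg P j N => weight C η w c m2 (0 : VecField P j ℝ) φ * massForm w φ) = fun φ =>
        ∑ z : Site P j, weight C η w c m2 (0 : VecField P j ℝ) φ * (w * ⟪φ z, (1 : EuclideanSpace ℝ (Fin N) →L[ℝ] EuclideanSpace ℝ (Fin N)) (φ z)⟫_ℝ) := by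
      funext φ
      rw [massForm, Finset.mul_sum]
      exact Finset.sum_congr rfl fun z _ => by rw [hq z φ]
    rw [e, integral_finsetSum _ (fun z _ => hi z)]
    refine Finset.sum_congr rfl fun z _ => ?_
    rw [← integral_const_mul]
    exact integral_congr_ae (Filter.Eventually.of_forall fun φ => by ring)
  rw [hA, hB, Finset.sum_mul, Finset.mul_sum, ← Finset.sum_sub_distrib, Finset.sum_div]
  refine Finset.sum_congr rfl fun z _ => ?_
  have hz := cum3_bil_sumWick4_sq C η w c m2 hw hm z z (1 : EuclideanSpace ℝ (Fin N) →L[ℝ] EuclideanSpace ℝ (Fin N))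
  rw [trE_one] at hz
  have hZ : (∫ φ, weight C η w c m2 (0 : VecField P j ℝ) φ) ≠ 0 := (B3WT226Traces.Z_pos C η w c m2 hw hm).ne'
  rw [div_eq_iff (pow_ne_zero 2 hZ)] at hz
  rw [show w * (∫ φ, weight C η w c m2 (0 : VecField P j ℝ) φ *
        (⟪φ z, (1 : EuclideanSpace ℝ (Fin N) →L[ℝ] EuclideanSpace ℝ (Fin N)) (φ z)⟫_ℝ *
          ((∑ y : Site P j, w * wick4 w c m2 y φ) * (∑ y : Site P j, w * wick4 w c m2 y φ)))) * (∫ φ, weight C η w c m2 (0 : VecField P j ℝ) φ)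
      - (∫ φ, weight C η w c m2 (0 : VecField P j ℝ) φ * ((∑ y : Site P j, w * wick4 w c m2 y φ) * (∑ y : Site P j, w * wick4 w c m2 y φ))) *
        (w * ∫ φ, weight C η w c m2 (0 : VecField P j ℝ) φ * ⟪φ z, (1 : EuclideanSpace ℝ (Fin N) →L[ℝ] EuclideanSpace ℝ (Fin N)) (φ z)⟫_ℝ)
      = w * ((∑ y : Site P j, ∑ y' : Site P j, w * w * (32 * (↑N + 2) * G w c m2 y' y ^ 3 * ↑N *
          (G w c m2 z y * G w c m2 y' z + G w c m2 z y * G w c m2 y' z))) * (∫ φ, weight C η w c m2 (0 : VecField P j ℝ) φ) ^ 2) by rw [← hz]; ring,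
    mul_div_assoc, mul_div_cancel_right₀ _ (pow_ne_zero 2 hZ)]
  congr 1
  refine Finset.sum_congr rfl fun y _ => Finset.sum_congr rfl fun y' _ => by ring

/-! ## §5 A FINITE FAMILY OF BILINEAR INSERTIONS (linearity of the cumulant): `X = Σ_l κ_l⟪φ(u_l),M_lφ(v_l)⟫` — the shape of
print's ② after the `A`-integration (`l` = bonds, `κ_b = η^dc²η²C^ε(b₋,b₋)`, `M = q²`, `(u,v) = (b₋,b₊)`; BRICK 7 `integral_D2_J_zero`) -/

/-- **A SUM OF BILINEAR INSERTIONS ON A SUNSET LINE, CONNECTED**: for `X = Σ_{l∈s} κ_l⟪φ(u_l),M_lφ(v_l)⟫`,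
`[∫W₀(X·V_:²)·Z₀ − ∫W₀V_:²·∫W₀X]/Z₀² = Σ_{l∈s} κ_l·Σ_{y,y′}η^{2d}·32(N+2)tr M_l·C₀(y′,y)³(C₀(u_l,y)C₀(y′,v_l) + C₀(v_l,y)C₀(y′,u_l))`
(§3 termwise; the cumulant is linear in the insertion) — with `s` = the bonds, `κ_b = η^dc²η²C^ε(b₋,b₋)`, `M_b = q²`,
`(u_b,v_b) = (b₋,b₊)` this is the ② part of BRICK 17's `κ₃(Y; V_:, V_:)`: the sunset with one line dressed by the `A`-tadpole of
the seagull vertex. [cite: Balaban1983Higgs3, (1.22)–(1.24) pp.416–417] [cite: GlimmJaffeQP1987, Cor. 8.3.2, §8.5] -/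
theorem cum3_sumBil_sumWick4_sq (hw : 0 < w) (hm : 0 < m2) {ι : Type*} (s : Finset ι) (κ : ι → ℝ)
    (u v : ι → Site P j) (M : ι → (EuclideanSpace ℝ (Fin N) →L[ℝ] EuclideanSpace ℝ (Fin N))) :
    ((∫ φ, weight C η w c m2 (0 : VecField P j ℝ) φ * ((∑ l ∈ s, κ l * ⟪φ (u l), M l (φ (v l))⟫_ℝ) *
          ((∑ y : Site P j, w * wick4 w c m2 y φ) * (∑ y : Site P j, w * wick4 w c m2 y φ)))) * (∫ φ, weight C η w c m2 (0 : VecField P j ℝ) φ)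
        - (∫ φ, weight C η w c m2 (0 : VecField P j ℝ) φ * ((∑ y : Site P j, w * wick4 w c m2 y φ) * (∑ y : Site P j, w * wick4 w c m2 y φ))) *
          (∫ φ, weight C η w c m2 (0 : VecField P j ℝ) φ * ∑ l ∈ s, κ l * ⟪φ (u l), M l (φ (v l))⟫_ℝ)) / (∫ φ, weight C η w c m2 (0 : VecField P j ℝ) φ) ^ 2 =
      ∑ l ∈ s, κ l * ∑ y : Site P j, ∑ y' : Site P j, w * w *
        (32 * (N + 2) * G w c m2 y' y ^ 3 * trE (M l) *
          (G w c m2 (u l) y * G w c m2 y' (v l) + G w c m2 (v l) y * G w c m2 y' (u l))) := by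
  have eV : ExpGrowth (fun φ : Cfg P j N => ∑ y : Site P j, w * wick4 w c m2 y φ) := expGrowth_sum_wick4 w c m2
  -- the two integrals containing `X`, split over the family
  have hA : ∫ φ, weight C η w c m2 (0 : VecField P j ℝ) φ * ((∑ l ∈ s, κ l * ⟪φ (u l), M l (φ (v l))⟫_ℝ) *
        ((∑ y : Site P j, w * wick4 w c m2 y φ) * (∑ y : Site P j, w * wick4 w c m2 y φ))) =
      ∑ l ∈ s, κ l * ∫ φ, weight C η w c m2 (0 : VecField P j ℝ) φ * (⟪φ (u l), M l (φ (v l))⟫_ℝ *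
        ((∑ y : Site P j, w * wick4 w c m2 y φ) * (∑ y : Site P j, w * wick4 w c m2 y φ))) := by
    have hi : ∀ l ∈ s, Integrable (fun φ : Cfg P j N => weight C η w c m2 (0 : VecField P j ℝ) φ *
        (κ l * (⟪φ (u l), M l (φ (v l))⟫_ℝ *
          ((∑ y : Site P j, w * wick4 w c m2 y φ) * (∑ y : Site P j, w * wick4 w c m2 y φ))))) := fun l _ =>
      (((ExpGrowth.inner_op_apply (u l) (v l) (M l)).mul (eV.mul eV)).const_mul (κ l)).integrable C η w c m2 hw hm
    have e : (fun φ : Cfg P j N => weight C η w c m2 (0 : VecField P j ℝ) φ * ((∑ l ∈ s, κ l * ⟪φ (u l), M l (φ (v l))⟫_ℝ) *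
        ((∑ y : Site P j, w * wick4 w c m2 y φ) * (∑ y : Site P j, w * wick4 w c m2 y φ)))) = fun φ =>
        ∑ l ∈ s, weight C η w c m2 (0 : VecField P j ℝ) φ * (κ l * (⟪φ (u l), M l (φ (v l))⟫_ℝ *
          ((∑ y : Site P j, w * wick4 w c m2 y φ) * (∑ y : Site P j, w * wick4 w c m2 y φ)))) := by
      funext φ
      rw [Finset.sum_mul, Finset.mul_sum]
      exact Finset.sum_congr rfl fun l _ => by ring
    rw [e, integral_finsetSum _ hi]
    refine Finset.sum_congr rfl fun l _ => ?_
    rw [← integral_const_mul]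
    exact integral_congr_ae (Filter.Eventually.of_forall fun φ => by ring)
  have hB : ∫ φ, weight C η w c m2 (0 : VecField P j ℝ) φ * ∑ l ∈ s, κ l * ⟪φ (u l), M l (φ (v l))⟫_ℝ =
      ∑ l ∈ s, κ l * ∫ φ, weight C η w c m2 (0 : VecField P j ℝ) φ * ⟪φ (u l), M l (φ (v l))⟫_ℝ := by
    have hi : ∀ l ∈ s, Integrable (fun φ : Cfg P j N => weight C η w c m2 (0 : VecField P j ℝ) φ * (κ l * ⟪φ (u l), M l (φ (v l))⟫_ℝ)) := fun l _ =>
      ((ExpGrowth.inner_op_apply (u l) (v l) (M l)).const_mul (κ l)).integrable C η w c m2 hw hm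
    have e : (fun φ : Cfg P j N => weight C η w c m2 (0 : VecField P j ℝ) φ * ∑ l ∈ s, κ l * ⟪φ (u l), M l (φ (v l))⟫_ℝ) = fun φ =>
        ∑ l ∈ s, weight C η w c m2 (0 : VecField P j ℝ) φ * (κ l * ⟪φ (u l), M l (φ (v l))⟫_ℝ) := by
      funext φ; rw [Finset.mul_sum]
    rw [e, integral_finsetSum _ hi]
    refine Finset.sum_congr rfl fun l _ => ?_
    rw [← integral_const_mul]
    exact integral_congr_ae (Filter.Eventually.of_forall fun φ => by ring)
  rw [hA, hB, Finset.sum_mul, Finset.mul_sum, ← Finset.sum_sub_distrib, Finset.sum_div]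
  refine Finset.sum_congr rfl fun l _ => ?_
  have hl := cum3_bil_sumWick4_sq C η w c m2 hw hm (u l) (v l) (M l)
  have hZ : (∫ φ, weight C η w c m2 (0 : VecField P j ℝ) φ) ≠ 0 := (B3WT226Traces.Z_pos C η w c m2 hw hm).ne'
  rw [div_eq_iff (pow_ne_zero 2 hZ)] at hl
  rw [show κ l * (∫ φ, weight C η w c m2 (0 : VecField P j ℝ) φ * (⟪φ (u l), M l (φ (v l))⟫_ℝ *
          ((∑ y : Site P j, w * wick4 w c m2 y φ) * (∑ y : Site P j, w * wick4 w c m2 y φ)))) * (∫ φ, weight C η w c m2 (0 : VecField P j ℝ) φ)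
      - (∫ φ, weight C η w c m2 (0 : VecField P j ℝ) φ * ((∑ y : Site P j, w * wick4 w c m2 y φ) * (∑ y : Site P j, w * wick4 w c m2 y φ))) *
        (κ l * ∫ φ, weight C η w c m2 (0 : VecField P j ℝ) φ * ⟪φ (u l), M l (φ (v l))⟫_ℝ)
      = κ l * ((∑ y : Site P j, ∑ y' : Site P j, w * w *
          (32 * (↑N + 2) * G w c m2 y' y ^ 3 * trE (M l) *
            (G w c m2 (u l) y * G w c m2 y' (v l) + G w c m2 (v l) y * G w c m2 y' (u l)))) * (∫ φ, weight C η w c m2 (0 : VecField P j ℝ) φ) ^ 2)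
      by rw [← hl]; ring,
    mul_div_assoc, mul_div_cancel_right₀ _ (pow_ne_zero 2 hZ)]

end Literature.MathematicalPhysics.QuantumFieldTheory.Balaban1983to89.B3Eq124SunsetKernels

end
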